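import Mathlib
import Summits.NavierStokesRegularity.NavierStokesRegularity.Theorems.LandauTailLandauTailBlowupPointForce
import Summits.NavierStokesRegularity.NavierStokesRegularity.Theorems.LandauTailLandauTailBlowupTypeIIPrep

/-!
# Crux `LandauTail.LandauTailBlowup` (stmt-NavierStokesRegularity-1944), line `registered`, cycle c6:
  stub `landauTail_veryWeak_landau_pairing` — Landau's point force against a space–time test field

Helper file on the proof path of the crux item `stmt-NavierStokesRegularity-1944`
(`Summit.NavierStokesRegularity.NavierStokesRegularity.Theses.LandauTail.LandauTailBlowup`), lead c6: the
registered support stub `landauTail_veryWeak_landau_pairing` (R0). For Landau's steady jet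
`U = landauAxisField a A` (unit axis `a`, `A > 1`, viscosity `1`) and a space–time test field `ψ` of the unit
parabolic cylinder `Q₁ = (−1,0) × B₁` with divergence-free slices, the pressure-free ("very weak",
Koch–Nadirashvili–Seregin–Šverák 2009, §4 (ii)) space–time Navier–Stokes functional
`∫_{−1}^{0} ∫ (⟪U, ∂ₜψ⟫ + ⟪U, (U·∇)ψ⟫ + ⟪U, Δψ⟫) dx dt` equals `−β(A) ∫_{−1}^{0} ⟪a, ψ(t, 0)⟫ dt`,
`β(A) = 2π [(8A/3)(3A² + 1)/(A² − 1) − 4A² log ((A + 1)/(A − 1))]`: Landau's point force `β(A) a δ₀`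
(Landau 1944; Batchelor 1967, §4.6; Šverák, arXiv:math/0604550, §2 (2.3); Lemarié-Rieusset 2016, (10.48))
integrated in time.

* `landauTail_mem_unitCylinder` — membership in `Q₁`;
* `landauTail_integral_inner_timeDeriv_steady` — for a STEADY field `U ∈ L¹(B₁)` the `∂ₜ`-pairing
  `∫_{−1}^{0} ∫ ⟪U, ∂ₜψ⟫` vanishes (Fubini on `(−1,0) × ℝ³`, then `∫ ∂ₜψ(·, x) dt = 0` for each `x` by the
  fundamental theorem of calculus and the compact time support), with the slice and time integrability;
* `landauTail_veryWeak_steady_pairing` — for a `(−1)`-homogeneous steady field continuous off the origin whose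
  slice functional `∫ (⟪U,(U·∇)φ⟫ + ⟪U,Δφ⟫) = −β ⟪b, φ 0⟫` is a point force, the space–time functional is
  `−β ∫ ⟪b, ψ(t,0)⟫ dt`;
* `landauTail_veryWeak_landau_pairing` — the registered stub (the previous theorem and the slice identity
  `landauTail_landau_point_force`).
-/

set_option linter.dupNamespace false

noncomputable section

open MeasureTheory Set Function Filter Metric TopologicalSpace InnerProductSpace
open scoped NNReal ENNReal Topology RealInnerProductSpace Laplacian
open Literature.Analysis.FluidPDE

namespace Summit.NavierStokesRegularity.NavierStokesRegularity.Theorems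

/-- Membership in the unit parabolic cylinder `Q₁(0,0) = (−1, 0) × B₁`. [folklore] -/
theorem landauTail_mem_unitCylinder {z : ℝ × EuclideanSpace ℝ (Fin 3)}
    (hz : z ∈ (parabolicCylinderOpens 1 ((0 : ℝ), (0 : EuclideanSpace ℝ (Fin 3))) :
      Set (ℝ × EuclideanSpace ℝ (Fin 3)))) :
    z.1 ∈ Ioo (-1 : ℝ) 0 ∧ z.2 ∈ ball (0 : EuclideanSpace ℝ (Fin 3)) 1 := by
  rw [coe_parabolicCylinderOpens, mem_parabolicCylinder] at hz
  obtain ⟨⟨h1, h2⟩, h3⟩ := hz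
  exact ⟨⟨by linarith, by simpa using h2⟩, by simpa [mem_ball] using h3⟩

/-- **The `∂ₜ`-pairing of a steady field vanishes.** For a steady field `U`, a.e. strongly measurable and
integrable on the unit ball, and a space–time test field `ψ` of the unit parabolic cylinder
`Q₁ = (−1,0) × B₁`: every slice pairing `x ↦ ⟪U x, ∂ₜψ(t,x)⟫` is integrable (it is dominated by
`M |U| 1_{B₁}`, `M = sup |∂ₜψ|`), `t ↦ ∫ ⟪U, ∂ₜψ(t,·)⟫` is integrable on `(−1,0)`, and
`∫_{−1}^{0} ∫ ⟪U, ∂ₜψ⟫ dx dt = 0`: Fubini on `(−1,0) × ℝ³`, then for each `x` the time integral is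
`⟪U x, ∫ ∂ₜψ(·,x) dt⟫ = 0` by the fundamental theorem of calculus (`ψ(·,x)` is smooth with compact support
in `(−1,0)`). [folklore] -/
theorem landauTail_integral_inner_timeDeriv_steady
    {U : EuclideanSpace ℝ (Fin 3) → EuclideanSpace ℝ (Fin 3)} (hUm : AEStronglyMeasurable U volume)
    (hUi : IntegrableOn U (ball (0 : EuclideanSpace ℝ (Fin 3)) 1) volume)
    {ψ : ℝ → EuclideanSpace ℝ (Fin 3) → EuclideanSpace ℝ (Fin 3)}
    (hψ : IsSpaceTimeTestOn (parabolicCylinderOpens 1 ((0 : ℝ), (0 : EuclideanSpace ℝ (Fin 3)))) ψ) :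
    (∀ t, Integrable fun x => ⟪U x, timeDeriv ψ t x⟫) ∧
    Integrable (fun t => ∫ x, ⟪U x, timeDeriv ψ t x⟫) (volume.restrict (Ioo (-1 : ℝ) 0)) ∧
    ∫ t in Ioo (-1 : ℝ) 0, ∫ x, ⟪U x, timeDeriv ψ t x⟫ = 0 := by
  -- uniform bound, continuity and support of `∂ₜψ`
  obtain ⟨M, hM0, hM⟩ := hψ.exists_uniform_bound
  have c1 : Continuous (uncurry (timeDeriv ψ)) := hψ.continuous_timeDeriv
  have cd : ∀ t, Continuous (timeDeriv ψ t) := fun t => c1.comp (Continuous.prodMk_right t)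
  have hzero : ∀ t x, (t, x) ∉ (parabolicCylinderOpens 1 ((0 : ℝ), (0 : EuclideanSpace ℝ (Fin 3))) :
      Set (ℝ × EuclideanSpace ℝ (Fin 3))) → timeDeriv ψ t x = 0 := fun t x h =>
    (derived_eq_zero_of_notMem_tsupport fun h' => h (hψ.tsupport_subset h')).1
  have hzero_x : ∀ t, ∀ x ∉ ball (0 : EuclideanSpace ℝ (Fin 3)) 1, timeDeriv ψ t x = 0 :=
    fun t x hx => hzero t x fun h => hx (landauTail_mem_unitCylinder h).2
  have hzero_t : ∀ t ∉ Ioo (-1 : ℝ) 0, ∀ x, timeDeriv ψ t x = 0 :=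
    fun t ht x => hzero t x fun h => ht (landauTail_mem_unitCylinder h).1
  -- the majorant `M |1_{B₁} U|`
  have hgi : Integrable fun x => M * ‖(ball (0 : EuclideanSpace ℝ (Fin 3)) 1).indicator U x‖ :=
    (hUi.integrable_indicator measurableSet_ball).norm.const_mul M
  have hbound : ∀ t x, ‖⟪U x, timeDeriv ψ t x⟫‖ ≤
      M * ‖(ball (0 : EuclideanSpace ℝ (Fin 3)) 1).indicator U x‖ := by
    intro t x
    by_cases hx : x ∈ ball (0 : EuclideanSpace ℝ (Fin 3)) 1
    · rw [indicator_of_mem hx, mul_comm]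
      exact (norm_inner_le_norm _ _).trans (mul_le_mul_of_nonneg_left (hM t x).1 (norm_nonneg _))
    · rw [hzero_x t x hx, inner_zero_right, norm_zero]
      exact mul_nonneg hM0 (norm_nonneg _)
  have hI : ∀ t, Integrable fun x => ⟪U x, timeDeriv ψ t x⟫ := fun t =>
    hgi.mono' (hUm.inner (cd t).aestronglyMeasurable) (Eventually.of_forall (hbound t))
  have hprod : Integrable (uncurry fun t x => ⟪U x, timeDeriv ψ t x⟫)
      ((volume.restrict (Ioo (-1 : ℝ) 0)).prod volume) :=
    (hgi.comp_snd (volume.restrict (Ioo (-1 : ℝ) 0))).mono' (hUm.comp_snd.inner c1.aestronglyMeasurable)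
      (Eventually.of_forall fun z => hbound z.1 z.2)
  refine ⟨hI, hprod.integral_prod_left, ?_⟩
  -- Fubini, then the fundamental theorem of calculus on each time line
  have hx : ∀ x, ∫ t in Ioo (-1 : ℝ) 0, ⟪U x, timeDeriv ψ t x⟫ = 0 := by
    intro x
    have hline : HasCompactSupport fun s => ψ s x :=
      HasCompactSupport.intro (isCompact_Icc (a := (-1 : ℝ)) (b := 0)) fun s hs =>
        hψ.apply_eq_zero fun h => hs (Ioo_subset_Icc_self (landauTail_mem_unitCylinder h).1)
    have hlinec : Continuous fun s => ψ s x :=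
      hψ.contDiff.continuous.comp (Continuous.prodMk_left x)
    have hdl : HasCompactSupport fun s => timeDeriv ψ s x := hline.deriv
    have hdlc : Continuous fun s => timeDeriv ψ s x := c1.comp (Continuous.prodMk_left x)
    have hdli : Integrable fun s => timeDeriv ψ s x := hdlc.integrable_of_hasCompactSupport hdl
    have h0 : ∫ t, timeDeriv ψ t x = 0 :=
      integral_eq_zero_of_hasDerivAt_of_integrable (fun s => hψ.hasDerivAt_time s x) hdli
        (hlinec.integrable_of_hasCompactSupport hline)
    calc ∫ t in Ioo (-1 : ℝ) 0, ⟪U x, timeDeriv ψ t x⟫ = ∫ t, ⟪U x, timeDeriv ψ t x⟫ :=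
          setIntegral_eq_integral_of_forall_compl_eq_zero fun t ht => by
            rw [hzero_t t ht x, inner_zero_right]
      _ = 0 := by rw [integral_inner hdli (U x), h0, inner_zero_right]
  rw [integral_integral_swap hprod]
  simp only [hx, integral_zero]

/-- **The very weak functional of a steady point-force field.** Let `U` be continuous off the origin and
homogeneous of degree `−1`, and suppose its steady slice functional is a point force:
`∫ (⟪U,(U·∇)φ⟫ + ⟪U,Δφ⟫) = −β ⟪b, φ 0⟫` for every smooth compactly supported divergence-free `φ`. Then for
every space–time test field `ψ` of `Q₁ = (−1,0) × B₁` with divergence-free slices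
`∫_{−1}^{0} ∫ (⟪U, ∂ₜψ⟫ + ⟪U, (U·∇)ψ⟫ + 1·⟪U, Δψ⟫) dx dt = −β ∫_{−1}^{0} ⟪b, ψ(t,0)⟫ dt`: slice by slice the
spatial integral splits into `∫⟪U, ∂ₜψ(t,·)⟫` (whose time integral vanishes,
`landauTail_integral_inner_timeDeriv_steady`) and the point force. [folklore] -/
theorem landauTail_veryWeak_steady_pairing
    {U : EuclideanSpace ℝ (Fin 3) → EuclideanSpace ℝ (Fin 3)} (hUc : ContinuousOn U {0}ᶜ)
    (hhom : ∀ c : ℝ, 0 < c → ∀ x, U (c • x) = c⁻¹ • U x) {β : ℝ} {b : EuclideanSpace ℝ (Fin 3)}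
    (hforce : ∀ φ : EuclideanSpace ℝ (Fin 3) → EuclideanSpace ℝ (Fin 3), ContDiff ℝ (⊤ : ℕ∞) φ →
      HasCompactSupport φ → (∀ x, VectorCalculus.divergence φ x = 0) →
      ∫ x, (⟪U x, convect U φ x⟫ + ⟪U x, Δ φ x⟫) = -(β * ⟪b, φ 0⟫))
    {ψ : ℝ → EuclideanSpace ℝ (Fin 3) → EuclideanSpace ℝ (Fin 3)}
    (hψ : IsSpaceTimeTestOn (parabolicCylinderOpens 1 ((0 : ℝ), (0 : EuclideanSpace ℝ (Fin 3)))) ψ)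
    (hdiv : ∀ t x, VectorCalculus.divergence (ψ t) x = 0) :
    ∫ t in Ioo (-1 : ℝ) 0, ∫ x, (⟪U x, timeDeriv ψ t x⟫ + ⟪U x, convect U (ψ t) x⟫ +
        1 * ⟪U x, Δ (ψ t) x⟫) = -β * ∫ t in Ioo (-1 : ℝ) 0, ⟪b, ψ t 0⟫ := by
  have hUm : AEStronglyMeasurable U volume := (landauTail_profile_measurable hUc).aestronglyMeasurable
  -- `U ∈ L¹(B₁)` from the envelope `K/|x|`
  have hUi : IntegrableOn U (ball (0 : EuclideanSpace ℝ (Fin 3)) 1) volume := by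
    obtain ⟨K, -, hK⟩ := landauTail_profile_norm_le hUc hhom
    refine Integrable.mono'
      ((NewtonPotentialHolder.integrableOn_ball_norm_rpow_neg (by norm_num : (1 : ℝ) < 3) 1).const_mul K)
      hUm.restrict ?_
    rw [ae_restrict_iff' measurableSet_ball]
    filter_upwards [compl_mem_ae_iff.2 (measure_singleton (0 : EuclideanSpace ℝ (Fin 3)))] with x hx _
    exact hK x hx
  obtain ⟨hI, hIt, h0⟩ := landauTail_integral_inner_timeDeriv_steady hUm hUi hψ
  -- the slices: `∫ F(U)(t,·) = ∫⟪U, ∂ₜψ(t,·)⟫ − β ⟪b, ψ(t,0)⟫`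
  have hslice : ∀ t, ∫ x, (⟪U x, timeDeriv ψ t x⟫ + ⟪U x, convect U (ψ t) x⟫ + 1 * ⟪U x, Δ (ψ t) x⟫) =
      (∫ x, ⟪U x, timeDeriv ψ t x⟫) + -(β * ⟪b, ψ t 0⟫) := by
    intro t
    have hJ : Integrable fun x => ⟪U x, convect U (ψ t) x⟫ + ⟪U x, Δ (ψ t) x⟫ :=
      landauTail_integrable_veryWeak hUc hhom ((hψ.contDiff_slice t).of_le (by norm_cast))
        (hψ.hasCompactSupport_slice t)
    rw [← hforce (ψ t) (hψ.contDiff_slice t) (hψ.hasCompactSupport_slice t) (hdiv t),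
      ← integral_add (hI t) hJ]
    exact integral_congr_ae (Eventually.of_forall fun x => by ring)
  -- time integration
  have hg : Integrable (fun t => ⟪b, ψ t 0⟫) (volume.restrict (Ioo (-1 : ℝ) 0)) := by
    have hcont : Continuous fun t => ⟪b, ψ t 0⟫ :=
      continuous_const.inner
        (hψ.contDiff.continuous.comp (Continuous.prodMk_left (0 : EuclideanSpace ℝ (Fin 3))))
    exact (hcont.integrableOn_Icc (a := (-1 : ℝ)) (b := 0)).mono_set Ioo_subset_Icc_self
  have hg' : Integrable (fun t => -(β * ⟪b, ψ t 0⟫)) (volume.restrict (Ioo (-1 : ℝ) 0)) :=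
    (hg.const_mul β).neg
  calc ∫ t in Ioo (-1 : ℝ) 0, ∫ x, (⟪U x, timeDeriv ψ t x⟫ + ⟪U x, convect U (ψ t) x⟫ +
          1 * ⟪U x, Δ (ψ t) x⟫)
        = ∫ t in Ioo (-1 : ℝ) 0, ((∫ x, ⟪U x, timeDeriv ψ t x⟫) + -(β * ⟪b, ψ t 0⟫)) :=
          integral_congr_ae (Eventually.of_forall hslice)
    _ = (∫ t in Ioo (-1 : ℝ) 0, ∫ x, ⟪U x, timeDeriv ψ t x⟫) +
          ∫ t in Ioo (-1 : ℝ) 0, -(β * ⟪b, ψ t 0⟫) := integral_add hIt hg'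
    _ = -β * ∫ t in Ioo (-1 : ℝ) 0, ⟪b, ψ t 0⟫ := by
          rw [h0, zero_add, integral_neg, integral_const_mul, neg_mul]

/-- **Landau's point force against a space–time test field** (registered support stub R0 of crux
stmt-NavierStokesRegularity-1944, lead c6). For Landau's steady jet `U = landauAxisField a A` (`‖a‖ = 1`,
`A > 1`, viscosity `1`) and every space–time test field `ψ` of the unit parabolic cylinder `Q₁ = (−1,0) × B₁`
with divergence-free slices, the very weak (pressure-free, KNSS 2009 §4 (ii)) space–time Navier–Stokes
functional is
`∫_{−1}^{0} ∫ (⟪U, ∂ₜψ⟫ + ⟪U, (U·∇)ψ⟫ + 1·⟪U, Δψ⟫) dx dt = −β(A) ∫_{−1}^{0} ⟪a, ψ(t,0)⟫ dt`,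
`β(A) = 2π [(8A/3)(3A² + 1)/(A² − 1) − 4A² log ((A + 1)/(A − 1))]` — Landau's point force `β(A) a δ₀`
(Landau 1944; Batchelor 1967, §4.6; Šverák, arXiv:math/0604550, §2 (2.3); Lemarié-Rieusset 2016, (10.48))
integrated in time: the `∂ₜ`-pairing of the steady field vanishes and each slice is
`landauTail_landau_point_force`. [folklore] -/
theorem landauTail_veryWeak_landau_pairing : ∀ (a : EuclideanSpace ℝ (Fin 3)) (A : ℝ) (ψ : ℝ → EuclideanSpace ℝ (Fin 3) → EuclideanSpace ℝ (Fin 3)), ‖a‖ = 1 → 1 < A → Literature.Analysis.FluidPDE.IsSpaceTimeTestOn (Literature.Analysis.FluidPDE.parabolicCylinderOpens 1 ((0 : ℝ), (0 : EuclideanSpace ℝ (Fin 3)))) ψ → (∀ t x, Literature.Analysis.FluidPDE.VectorCalculus.divergence (ψ t) x = 0) → ∫ t in Set.Ioo (-1 : ℝ) 0, ∫ x, (inner ℝ (Literature.Analysis.FluidPDE.landauAxisField a A x) (Literature.Analysis.FluidPDE.timeDeriv ψ t x) + inner ℝ (Literature.Analysis.FluidPDE.landauAxisField a A x) (Literature.Analysis.FluidPDE.convect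 (Literature.Analysis.FluidPDE.landauAxisField a A) (ψ t) x) + 1 * inner ℝ (Literature.Analysis.FluidPDE.landauAxisField a A x) (Laplacian.laplacian (ψ t) x)) = -(2 * Real.pi * (8 * A / 3 * (3 * A ^ 2 + 1) / (A ^ 2 - 1) - 4 * A ^ 2 * Real.log ((A + 1) / (A - 1)))) * ∫ t in Set.Ioo (-1 : ℝ) 0, inner ℝ a (ψ t 0) := by
  intro a A ψ ha hA hψ hdiv
  obtain ⟨hU, -, -, -, hhom, -⟩ := landauTail_landauAxisField_profile ha hA
  exact landauTail_veryWeak_steady_pairing hU.continuousOn hhom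
    (fun φ hφ hφc hφd => landauTail_landau_point_force a A φ ha hA hφ hφc hφd) hψ hdiv

end Summit.NavierStokesRegularity.NavierStokesRegularity.Theorems
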